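import Summits.Ventures.Crystal3D.Theorems.StickyWulffConstantCoaxialWallLawSeamJunkCapTable
import HarnessLib

/-!
# Junk sees the core through a TRIANGLE-FREE pattern: a ball outside the canonical core has at most EIGHT core balls among the twelve positions of any frame
# dozen around it; a junk ball at a dozen position of a core ball breaks both triangles there (crux `CoaxialWallLaw`, stmt-Ventures-19481; line `WallLedgerF`,
# skeleton 'CoaxialWallLawCertificates' v8.1, stub `stub_incoherentSeamSmall`, seam side)

HONEST FRAMING. Venture `Summits/Ventures/Crystal3D` (cell `crystal3d-full`); two structural lemmas for the SEAM side of lane F's T5b (`SeamSumSmall` /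
`SeamSparsity` of '…SeamIncoherentAssembly(Sum)'): what closure maximality (`…SeamCapClosure.mem_capClosure_of_capsTriangleIn`) says about the participants of a
seam pair that lie OUTSIDE the core `coreOf X z S`.  Nothing about the stubs is claimed; F-C1 not moved.
* `slotTri` — the eight triangles of the cuboctahedron (slot triples pairwise at integer dot `1`: the two triples `{2,6,8}`, `{1,5,11}` and the six
  «hexagon pair + apex» triangles), `slotTri_adj`; `card_triThrough_le_two` + `exists_slotTri_avoiding` — three slots never meet all eight triangles (each slot
  lies on two; union bound `≤ 6 < 8`); hence `exists_slotTri_subset` — any nine slots contain a triangle;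
* **`card_core_dozen_le_eight_of_not_mem_core`** — a window ball `x ∉ coreOf X z S` has, for EVERY frame `G`, at most eight of the twelve positions `x + G(slot)`
  occupied by core balls (nine would contain a triangle, and `x` would cap it).  For a FOREIGN READER `q` of a seam pair (FULL in an admissible frame: all twelve
  positions occupied) this says at least four of its twelve neighbours are junk too — a foreign reader is never a lone ball against the core;
* **`not_core_pair_at_junk_slot`** — if `q` is a core ball and the position `q + G(slot k)` carries a junk ball, then for each of the two triangles through `k`
  the other two positions are not both core (the (S2)/(S3) shapes of F-TAIL-g12 §5: a foreign end ball or a junk-completed reading needs a second gap or a second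
  junk ball next to it).
-/

noncomputable section

namespace Summit.Ventures.Crystal3D.Theorems

namespace TailResidue

open Summit.Ventures.Crystal3D Finset NearIdentity
open scoped InnerProductSpace

/-! ### The eight triangles of the cuboctahedron -/

/-- The eight TRIANGLES of the frame dozen (slot indices of `NearIdentity.slotInt`): upper triple, lower triple, and the six «adjacent hexagon pair + its fcc apex». -/
def slotTri : Fin 8 → Fin 12 × Fin 12 × Fin 12 :=
  ![(2, 6, 8), (1, 5, 11), (0, 4, 8), (1, 4, 10), (3, 6, 10), (3, 7, 11), (2, 7, 9), (0, 5, 9)]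

/-- The triangles are triangles: pairwise integer dot product `1` (distance `1`). -/
theorem slotTri_adj (i : Fin 8) :
    slotInt (slotTri i).1 ⬝ᵥ slotInt (slotTri i).2.1 = 1 ∧ slotInt (slotTri i).1 ⬝ᵥ slotInt (slotTri i).2.2 = 1 ∧
      slotInt (slotTri i).2.1 ⬝ᵥ slotInt (slotTri i).2.2 = 1 := by
  revert i; decide

/-- The triangles through a slot. -/
def triThrough (k : Fin 12) : Finset (Fin 8) := univ.filter fun i => k = (slotTri i).1 ∨ k = (slotTri i).2.1 ∨ k = (slotTri i).2.2

/-- **Every slot lies on at most two (in fact exactly two) of the eight triangles.** -/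
theorem card_triThrough_le_two (k : Fin 12) : (triThrough k).card ≤ 2 := by revert k; decide

/-- **Three slots never meet all eight triangles.** -/
theorem exists_slotTri_avoiding (C : Finset (Fin 12)) (hC : C.card ≤ 3) :
    ∃ i : Fin 8, ∀ k ∈ C, ¬ (k = (slotTri i).1 ∨ k = (slotTri i).2.1 ∨ k = (slotTri i).2.2) := by
  have hle : (C.biUnion triThrough).card ≤ 6 :=
    card_biUnion_le.trans ((sum_le_sum fun k _ => card_triThrough_le_two k).trans (by rw [sum_const, smul_eq_mul]; omega))
  have hlt : (C.biUnion triThrough).card < (univ : Finset (Fin 8)).card := by rw [card_univ, Fintype.card_fin]; omega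
  obtain ⟨i, -, hi⟩ := exists_mem_notMem_of_card_lt_card hlt
  exact ⟨i, fun k hk hmem => hi (mem_biUnion.2 ⟨k, hk, mem_filter.2 ⟨mem_univ _, hmem⟩⟩)⟩

/-- **Any nine slots contain a triangle.** -/
theorem exists_slotTri_subset (T : Finset (Fin 12)) (hT : 9 ≤ T.card) : ∃ i : Fin 8, (slotTri i).1 ∈ T ∧ (slotTri i).2.1 ∈ T ∧ (slotTri i).2.2 ∈ T := by
  have hc : (univ \ T).card ≤ 3 := by rw [card_sdiff_of_subset (subset_univ T), card_univ, Fintype.card_fin]; omega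
  obtain ⟨i, hi⟩ := exists_slotTri_avoiding _ hc
  have mem : ∀ k : Fin 12, (k = (slotTri i).1 ∨ k = (slotTri i).2.1 ∨ k = (slotTri i).2.2) → k ∈ T := fun k hk => by
    by_contra h
    exact hi k (mem_sdiff.2 ⟨mem_univ k, h⟩) hk
  exact ⟨i, mem _ (Or.inl rfl), mem _ (Or.inr (Or.inl rfl)), mem _ (Or.inr (Or.inr rfl))⟩

/-! ### Junk sees the core through a triangle-free pattern -/

/-- Adjacent slots (integer dot product `1`), transported by a frame and attached to a ball, are at distance `1`. -/
theorem dist_add_slotSite_eq_one (G : EuclideanSpace ℝ (Fin 3) ≃ₗᵢ[ℝ] EuclideanSpace ℝ (Fin 3)) (x : EuclideanSpace ℝ (Fin 3)) {a b : Fin 12}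
    (h : slotInt a ⬝ᵥ slotInt b = 1) : dist (x + G (slotSite a)) (x + G (slotSite b)) = 1 := by
  rw [dist_eq_norm, add_sub_add_left_eq_sub, ← map_sub, LinearIsometryEquiv.norm_map, ← dist_eq_norm]
  exact dist_slotSite_slotSite_eq_one h

/-- A ball at the centre of a frame dozen CAPS the triangle of any three pairwise adjacent dozen balls of `D`. -/
theorem capsTriangleIn_of_slotTriangle {D : Finset (EuclideanSpace ℝ (Fin 3))} (G : EuclideanSpace ℝ (Fin 3) ≃ₗᵢ[ℝ] EuclideanSpace ℝ (Fin 3))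
    (x : EuclideanSpace ℝ (Fin 3)) {a b c : Fin 12} (hab : slotInt a ⬝ᵥ slotInt b = 1) (hac : slotInt a ⬝ᵥ slotInt c = 1) (hbc : slotInt b ⬝ᵥ slotInt c = 1)
    (ha : x + G (slotSite a) ∈ D) (hb : x + G (slotSite b) ∈ D) (hc : x + G (slotSite c) ∈ D) : CapsTriangleIn D x :=
  ⟨_, ha, _, hb, _, hc, dist_add_slotSite_eq_one G x hab, dist_add_slotSite_eq_one G x hac, dist_add_slotSite_eq_one G x hbc,
    dist_slotSite_eq_one G x (slotSite_mem a), dist_slotSite_eq_one G x (slotSite_mem b), dist_slotSite_eq_one G x (slotSite_mem c)⟩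

open scoped Classical in
/-- **A ball outside the core has at most EIGHT core balls in any frame dozen around it.**  (`x` a window ball, i.e. within `3` of the payer; nine core positions
would contain a triangle of the cuboctahedron, which `x` caps — closure maximality.)  For a FOREIGN READER of a seam pair (all twelve positions occupied) at least
four of its neighbours are junk as well. -/
theorem card_core_dozen_le_eight_of_not_mem_core {X : Finset (EuclideanSpace ℝ (Fin 3))} {z : EuclideanSpace ℝ (Fin 3)}
    (S : EuclideanSpace ℝ (Fin 3) ≃ₗᵢ[ℝ] EuclideanSpace ℝ (Fin 3)) {x : EuclideanSpace ℝ (Fin 3)} (hx : x ∈ X) (hzx : dist z x ≤ 3) (hxD : x ∉ coreOf X z S)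
    (G : EuclideanSpace ℝ (Fin 3) ≃ₗᵢ[ℝ] EuclideanSpace ℝ (Fin 3)) :
    (univ.filter fun k : Fin 12 => x + G (slotSite k) ∈ coreOf X z S).card ≤ 8 := by
  by_contra hlt
  rw [not_le] at hlt
  obtain ⟨i, h1, h2, h3⟩ := exists_slotTri_subset _ hlt
  obtain ⟨hab, hac, hbc⟩ := slotTri_adj i
  have hcap : CapsTriangleIn (coreOf X z S) x :=
    capsTriangleIn_of_slotTriangle G x hab hac hbc (mem_filter.1 h1).2 (mem_filter.1 h2).2 (mem_filter.1 h3).2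
  exact hxD (mem_capClosure_of_capsTriangleIn (siteBallsAt_subset _ _ _) (mem_filter.2 ⟨hx, hzx⟩) hcap)

/-! ### A junk ball at a dozen position of a core ball -/

/-- **A junk ball at a dozen position of a CORE ball breaks both triangles there**: if `q ∈ coreOf X z S` and the position `q + G(slot k)` carries a ball of `X`
outside the core, then for every triangle `{k, k', k''}` of the cuboctahedron the positions `k', k''` are not both core. -/
theorem not_core_pair_at_junk_slot {X : Finset (EuclideanSpace ℝ (Fin 3))} {z : EuclideanSpace ℝ (Fin 3)}
    (S : EuclideanSpace ℝ (Fin 3) ≃ₗᵢ[ℝ] EuclideanSpace ℝ (Fin 3)) {q : EuclideanSpace ℝ (Fin 3)} (hq : q ∈ coreOf X z S)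
    (G : EuclideanSpace ℝ (Fin 3) ≃ₗᵢ[ℝ] EuclideanSpace ℝ (Fin 3)) {k k' k'' : Fin 12} (hkk' : slotInt k ⬝ᵥ slotInt k' = 1) (hkk'' : slotInt k ⬝ᵥ slotInt k'' = 1)
    (hk'k'' : slotInt k' ⬝ᵥ slotInt k'' = 1) (hx : q + G (slotSite k) ∈ X) (hzx : dist z (q + G (slotSite k)) ≤ 3) (hxD : q + G (slotSite k) ∉ coreOf X z S) :
    ¬ (q + G (slotSite k') ∈ coreOf X z S ∧ q + G (slotSite k'') ∈ coreOf X z S) := by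
  rintro ⟨h', h''⟩
  have hcap : CapsTriangleIn (coreOf X z S) (q + G (slotSite k)) := by
    refine ⟨q, hq, _, h', _, h'', dist_slotSite_eq_one G q (slotSite_mem k'), dist_slotSite_eq_one G q (slotSite_mem k''),
      dist_add_slotSite_eq_one G q hk'k'', ?_, dist_add_slotSite_eq_one G q hkk', dist_add_slotSite_eq_one G q hkk''⟩
    rw [dist_comm]; exact dist_slotSite_eq_one G q (slotSite_mem k)
  exact hxD (mem_capClosure_of_capsTriangleIn (siteBallsAt_subset _ _ _) (mem_filter.2 ⟨hx, hzx⟩) hcap)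

end TailResidue

end Summit.Ventures.Crystal3D.Theorems

end
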